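import Summits.NavierStokesRegularity.NavierStokesRegularity.Theorems.PoloidalWindowDoorPoloidalWindowRigidityZShockRotatingProfileSlice
import Summits.NavierStokesRegularity.NavierStokesRegularity.Theorems.PoloidalWindowDoorPoloidalWindowRigidityZShockRotatingProfileLinearWitness
import HarnessLib

/-!
# Crux K2 `PoloidalWindowRigidity` (stmt-NavierStokesRegularity-19708), line `z_shock` — R3 inhabitant census: ROTATING PATTERNS of the
# autonomous thick height-evolution (VIII) — the linear witness IS a rotating slice solution: the LINEAR autonomous height-evolution
# `w_ss = Σᵢ ∂ᵢ(c² ∂ᵢ w)` has bounded, `C²`, non-stationary, rigidly rotating solutions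

`--supports stmt-NavierStokesRegularity-19708 --as helper` (leafhand-ns-poloidalwindowdoor-3 g9, cell decomp-ns, 2026-08-31).  Class-free,
def-free; parts I (`…ZShockRotatingProfile`), III (`…Slice`), VIIa/VII (`…LinearWitnessCalculus`, `…LinearWitness`).  **No stub and no summit
is closed by this file; Navier–Stokes regularity is NOT proved here (rung 0).**  Tightness fact, continued (evidence #47 §2(b), brick F0).

WHY THIS FILE.  Part VII exhibited, for the linearly degenerate coefficient `γ ≡ c²`, a bounded non-constant `C²` profile `Ψ` solving the
rotating-pattern profile equation `ω² ΘΘΨ = Σᵢ ∂ᵢ(c² ∂ᵢΨ)` with `ΘΨ ≢ 0`.  Part III (`rotating_slice_solution_of_profile`) turns every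
solution of the profile equation into a rigidly rotating solution `W(s,y) = Ψ(R_{ωs} y)` of the slice equation `∂ₛ∂ₛW = Σᵢ ∂ᵢ(γ(W)∂ᵢW)` —
the `(s,y)`-typing of the autonomous column of `stub_zShockThickAut` (`…ZShockSliceTyping.slice_wave_pde`).  Composing the two:

* ★ `linear_rotating_slice_inhabitant` — for `ω ≠ 0`, `c ≠ 0` there is a `C²` profile `Ψ`, `|Ψ| ≤ 2π`, whose rotating pattern
  `W(s,y) = Ψ(R_{ωs}y)` solves `∂ₛ∂ₛW = Σᵢ ∂ᵢ(c² ∂ᵢW)` at EVERY height `s` and every point `y`, and is NOT stationary: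
  `∂ₛW(0,·) = ω·ΘΨ ≢ 0` (part I's orbit formula + part VII's `witness_angularDeriv_not_zero`).

So the inhabitant class «rotating patterns of the autonomous column» is NON-EMPTY as soon as the thick clause `γ' ≢ 0` is dropped: the
would-be rigidity of `stub_zShockThickAut` for rotating patterns cannot come from the wave operator, the rotation ansatz, boundedness or
smoothness — only from genuine nonlinearity (cumulative steepening of the outgoing spiral waves, census items F3/F4).  Elementary; nothing is
claimed about thick `γ`. presearch: classical (rotating modes `J₁(kr)cos(θ − ωs)` of the 2-D wave equation); folklore. [folklore]
-/

noncomputable section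

namespace Summit.NavierStokesRegularity.NavierStokesRegularity.Theorems.PoloidalWindowDoorPoloidalWindowRigidityZShockRotatingProfileLinearWitnessSlice

-- the summit and its single sub-problem share the name (CONVENTIONS §1)
set_option linter.dupNamespace false

open Set Filter Topology Function MeasureTheory intervalIntegral
open Summit.NavierStokesRegularity.NavierStokesRegularity.Theorems.PoloidalWindowDoorPoloidalWindowRigidityZShockRotatingProfile PoloidalWindowDoorPoloidalWindowRigidityZShockRotatingProfileSlice PoloidalWindowDoorPoloidalWindowRigidityZShockRotatingProfileLinearWitnessCalculus PoloidalWindowDoorPoloidalWindowRigidityZShockRotatingProfileLinearWitness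

variable {J : EuclideanSpace ℝ (Fin 2) → EuclideanSpace ℝ (Fin 2)}

/-- ★ **The linear autonomous height-evolution has bounded non-stationary rotating solutions.**  For `ω ≠ 0`, `c ≠ 0` there is
`Ψ ∈ C²(ℝ²)`, `|Ψ| ≤ 2π`, such that the rigidly rotating pattern `W(s,y) = Ψ(R_{ωs}y)` satisfies the slice equation
`∂ₛ∂ₛW(s,y) = Σᵢ ∂ᵢ(c² ∂ᵢW(s,·))(y)` for all `s, y` (typing of `…ZShockSliceTyping.slice_wave_pde` with `γ ≡ c²`), while
`∂ₛW(0,y) ≠ 0` for some `y` (the pattern really turns).  [folklore] -/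
theorem linear_rotating_slice_inhabitant {ω c : ℝ} (hω : ω ≠ 0) (hc : c ≠ 0)
    (hJ : ∀ y' : EuclideanSpace ℝ (Fin 2), J y' = (-(y' 1)) • EuclideanSpace.single (0 : Fin 2) (1 : ℝ) +
      (y' 0) • EuclideanSpace.single (1 : Fin 2) (1 : ℝ)) :
    ∃ Ψ : EuclideanSpace ℝ (Fin 2) → ℝ, ContDiff ℝ 2 Ψ ∧ (∀ y, |Ψ y| ≤ 2 * Real.pi) ∧
      (∀ (s : ℝ) (y : EuclideanSpace ℝ (Fin 2)),
        deriv (fun s' => deriv (fun s'' => Ψ ((Real.cos (ω * s'') * y 0 - Real.sin (ω * s'') * y 1) • EuclideanSpace.single (0 : Fin 2) (1 : ℝ) +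
            (Real.sin (ω * s'') * y 0 + Real.cos (ω * s'') * y 1) • EuclideanSpace.single (1 : Fin 2) (1 : ℝ))) s') s =
          ∑ i, fderiv ℝ (fun y' => c ^ 2 *
            fderiv ℝ (fun y'' : EuclideanSpace ℝ (Fin 2) => Ψ ((Real.cos (ω * s) * y'' 0 - Real.sin (ω * s) * y'' 1) •
                EuclideanSpace.single (0 : Fin 2) (1 : ℝ) +
              (Real.sin (ω * s) * y'' 0 + Real.cos (ω * s) * y'' 1) • EuclideanSpace.single (1 : Fin 2) (1 : ℝ))) y'
              (EuclideanSpace.single i 1)) y (EuclideanSpace.single i 1)) ∧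
      ¬ (∀ y : EuclideanSpace ℝ (Fin 2), deriv (fun s'' => Ψ ((Real.cos (ω * s'') * y 0 - Real.sin (ω * s'') * y 1) • EuclideanSpace.single (0 : Fin 2) (1 : ℝ) +
            (Real.sin (ω * s'') * y 0 + Real.cos (ω * s'') * y 1) • EuclideanSpace.single (1 : Fin 2) (1 : ℝ))) 0 = 0) := by
  have hk : ω / c ≠ 0 := div_ne_zero hω hc
  have hck : c ^ 2 * (ω / c) ^ 2 = ω ^ 2 := by field_simp
  obtain ⟨L, hL⟩ : ∃ L : ℝ → EuclideanSpace ℝ (Fin 2) →L[ℝ] ℝ, ∀ t, L t =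
      Real.cos t • (EuclideanSpace.proj (𝕜 := ℝ) (0 : Fin 2) : EuclideanSpace ℝ (Fin 2) →L[ℝ] ℝ) +
      Real.sin t • (EuclideanSpace.proj (𝕜 := ℝ) (1 : Fin 2) : EuclideanSpace ℝ (Fin 2) →L[ℝ] ℝ) := ⟨_, fun t => rfl⟩
  obtain ⟨Ψ, hΨ⟩ : ∃ Ψ : EuclideanSpace ℝ (Fin 2) → ℝ, ∀ y, Ψ y =
      ∫ t in (0 : ℝ)..2 * Real.pi, Real.cos (ω / c * (y 0 * Real.cos t + y 1 * Real.sin t) - t) := ⟨_, fun y => rfl⟩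
  obtain ⟨Ψ', hΨ'⟩ : ∃ Ψ' : EuclideanSpace ℝ (Fin 2) → EuclideanSpace ℝ (Fin 2) →L[ℝ] ℝ, ∀ y, Ψ' y =
      ∫ t in (0 : ℝ)..2 * Real.pi, (-Real.sin (ω / c * (y 0 * Real.cos t + y 1 * Real.sin t) - t)) • ((ω / c) • L t) :=
    ⟨_, fun y => rfl⟩
  obtain ⟨Ψ'', hΨ''⟩ : ∃ Ψ'' : EuclideanSpace ℝ (Fin 2) → EuclideanSpace ℝ (Fin 2) →L[ℝ] (EuclideanSpace ℝ (Fin 2) →L[ℝ] ℝ),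
      ∀ y, Ψ'' y = ∫ t in (0 : ℝ)..2 * Real.pi,
        (-(Real.cos (ω / c * (y 0 * Real.cos t + y 1 * Real.sin t) - t) • ((ω / c) • L t))).smulRight ((ω / c) • L t) :=
    ⟨_, fun y => rfl⟩
  have hΨ2 : ContDiff ℝ 2 Ψ := witness_contDiff hL hΨ hΨ' hΨ''
  have hΨd : Differentiable ℝ Ψ := hΨ2.differentiable two_ne_zero
  -- the profile equation with the constant coefficient `γ ≡ c²`
  have hrot : ∀ y : EuclideanSpace ℝ (Fin 2), ω ^ 2 * fderiv ℝ (fun y' => fderiv ℝ Ψ y' (J y')) y (J y) =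
      ∑ i, fderiv ℝ (fun y' => (fun _ : ℝ => c ^ 2) (Ψ y') * fderiv ℝ Ψ y' (EuclideanSpace.single i 1)) y
        (EuclideanSpace.single i 1) := by
    intro y
    show ω ^ 2 * fderiv ℝ (fun y' => fderiv ℝ Ψ y' (J y')) y (J y) =
      ∑ i, fderiv ℝ (fun y' => c ^ 2 * fderiv ℝ Ψ y' (EuclideanSpace.single i 1)) y (EuclideanSpace.single i 1)
    rw [witness_angular hJ hL hΨ hΨ' hΨ'' y, witness_divergence hL hΨ hΨ' hΨ'' c y, hck]
    ring
  refine ⟨Ψ, hΨ2, witness_abs_le hΨ, fun s y => ?_, ?_⟩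
  · -- part III: the rotating pattern of a profile solution solves the slice equation at every height
    exact rotating_slice_solution_of_profile (γ := fun _ : ℝ => c ^ 2) hΨ2 contDiff_const hJ hrot s y
  · -- non-stationarity: `∂ₛW(0,y) = ω ΘΨ(y)` (part I) and `ΘΨ ≢ 0` (part VII)
    intro h0
    apply witness_angularDeriv_not_zero hJ hL hΨ hΨ' hΨ'' hk
    intro y
    have hcy : ∀ s : ℝ, (fun s'' : ℝ => (Real.cos (ω * s'') * y 0 - Real.sin (ω * s'') * y 1) • EuclideanSpace.single (0 : Fin 2) (1 : ℝ) +
            (Real.sin (ω * s'') * y 0 + Real.cos (ω * s'') * y 1) • EuclideanSpace.single (1 : Fin 2) (1 : ℝ)) s =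
        (Real.cos (ω * s) * y 0 - Real.sin (ω * s) * y 1) • EuclideanSpace.single (0 : Fin 2) (1 : ℝ) +
          (Real.sin (ω * s) * y 0 + Real.cos (ω * s) * y 1) • EuclideanSpace.single (1 : Fin 2) (1 : ℝ) := fun s => rfl
    have key : deriv (fun s'' => Ψ ((Real.cos (ω * s'') * y 0 - Real.sin (ω * s'') * y 1) • EuclideanSpace.single (0 : Fin 2) (1 : ℝ) +
            (Real.sin (ω * s'') * y 0 + Real.cos (ω * s'') * y 1) • EuclideanSpace.single (1 : Fin 2) (1 : ℝ))) 0 = ω * fderiv ℝ Ψ y (J y) := by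
      have h := (hasDerivAt_comp_rotOrbit hΨd hcy hJ 0).deriv
      rw [rotOrbit_zero hcy] at h
      exact h
    rw [h0 y] at key
    rcases mul_eq_zero.1 key.symm with h | h
    · exact absurd h hω
    · exact h

end Summit.NavierStokesRegularity.NavierStokesRegularity.Theorems.PoloidalWindowDoorPoloidalWindowRigidityZShockRotatingProfileLinearWitnessSlice
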